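import Summits.QuantumFields.YangMills.Theorems.BalabanUVNodesN12MinimiserFamilyKnitRowThm1LettersOnZOfRecordPos
import Summits.QuantumFields.YangMills.Theorems.BalabanUVNodesN12AtRecord13Prop1KnitThm1OfRecord
import Literature.MathematicalPhysics.QuantumFieldTheory.Balaban1983to89.B11Thm1ExistsUniqueCoP7M
import HarnessLib

/-!
# BalabanUVNodes ∕ N12 — THE (J0′) ROAD's HEAD OF RECORD KEYED ON TWO NAMED [15]-THEOREM-1 FACTS IN NODE 00's HOUSE SHAPE: (8) = K0⁷'s `Node00.VariationalThm1RegSepCoP7M` and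
# (E∕U) = `B11Thm1ExistsUniqueCoP7M.VariationalThm1EUSepCoP7M` — NO anonymous [15] letter left on N12's Proposition-1 road
# ([Balaban1985Variational] Thm 1 p.279, (1)–(8) pp.277–279; [Balaban1989LargeFieldI] (i) p.177, (1.74) p.192, p.193, Prop. 1 p.194; [Balaban1988Convergent] (2.1)–(2.2) pp.254–255,
# (2.12)–(2.13) pp.256–257, (2.18) p.257; [Balaban1985RegularSpaces] (1.3)–(1.9) p.77; [Balaban1989LargeFieldII] pp.357–359)

Cell `pub-ymgap` (HUMAN RULINGS D-0062 ∕ D-0149), lane `pub-ymgap-dag-n12-c` g29 (R134 seat (a), N12 = [B15], s1, LANE OWNER; knit-side pen ceded by dag-n12-d g25 I.29974); count-neutral helper of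
K1⁹ `stmt-QuantumFields-27364` (`--kind proof --supports … --as helper`).  THEOREMS ONLY (0 `def`, 0 `instance`, 0 `sorry`); ONE composition by name.

WHY.  After the g29 re-key the (J0′) road's head of record `…KnitRowThm1LettersOnZOfRecordPos.exists_R_hMinRow_of_thm1Letters_alongOrbit_onZ_ofRecord_pos` (✓p739277) displays the two
[15]-Theorem-1 inputs as CLOSED LETTERS in the torus-class shape: `h15T` ((8)) and `h15EUT⁺` (existence ∕ tower-central uniqueness at lengths `0 < k'`).  Both have house-shape NAMES:
(8) is K0⁷'s `Node00.VariationalThm1RegSepCoP7M F 2 B₃ a₀ a₁` read at the flat history `(M, g) := (ν.M₁, 1)` (dag-n12-d's junction `N12AtRecord13Prop1KnitThm1OfRecord.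
thm1TorusClass_of_variationalThm1RegSepCoP7M`), and (E∕U) is the lane's named fact `B11Thm1ExistsUniqueCoP7M.VariationalThm1EUSepCoP7M F 2 B₃ a₀ a₁` (same binders + `0 < k`) read the
same way (`B15Prop1Thm1RowsOfExistsUniquePos.thm1TorusClassEU_pos_of_thm1RecordEU_pos`).  THIS FILE is the head keyed on the two NAMES — so that the chair ∕ plan can book N12's (J0′) row
as «inhabited modulo K0⁷ + `VariationalThm1EUSepCoP7M`» with both debts tracked BY NAME, and a future N07 ∕ NODE-00 producer of either fact serves N12 with no further junction.

  ★★★★★ `exists_R_hMinRow_of_variationalThm1NamedFacts_alongOrbit_onZ_ofRecord`: ✓p739277's statement VERBATIM with its two letter binders replaced by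
  `(h15 : Node00.VariationalThm1RegSepCoP7M F 2 B₃ a₀ a₁) (h15EU : B11Thm1ExistsUniqueCoP7M.VariationalThm1EUSepCoP7M F 2 B₃ a₀ a₁)`; proof = ✓p739277 ∘ the two junctions.

«INHABITED BY» (director-ym №300∕№303): `h15` — OPEN: inhabitation not in tree (K0⁷ stmt-QuantumFields-20541; dag-n07-e's `variationalThm1RegSepCoP7M_of_prop8TopStep` reduces it to
[15] Prop. 8's top step); `h15EU` — OPEN: inhabitation not in tree (NO producer; [15] Props 2–9 in the multi-scale class; memo `pub-ymgap-dag-n12-c/N12-H15EU-ORPHAN-2026-08-29.md`).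
Every other displayed row is ✓p739277's (record numerics, (σ)_N numerics, print's box rows, tolerances) — jointly inhabited as read there (ref-I READ-707∕SECOND-GAP addendum, the
letter now guarded).

HONEST FRAMING ∕ LOCATED.  One composition by name; BOTH [15] facts are HYPOTHESES (named, never asserted); nothing of Bałaban's asserted; `δ₀`, `R`, `ρ″`, `εH` = EXISTENCE constants per
(instance, height) (census U4); scope = print's box scope; N12 NOT discharged; K0⁷ ∕ K1⁹ NOT closed; counts unmoved; one finite 𝕋⁴ programme at fixed `ε = L^{-K}` — R4 closes only the
conditional rung `BalabanLadder.UV`; no summit statement is proved here and NOT the Yang–Mills mass gap (Clay); nothing continuum ∕ ℝ⁴ ∕ OS.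
-/

noncomputable section

namespace Summit.QuantumFields.YangMills.BalabanUVNodes.N12MinimiserFamilyKnitRowThm1NamedFactsOnZOfRecord

open scoped BigOperators Matrix.Norms.L2Operator Topology
open Literature.MathematicalPhysics.QuantumFieldTheory.Balaban1983to89
open T4Continuum
open B15DeterminingSets GaugeField
open ExpMeanLog (deltaSU)
open B15Prop1AnalyticExtClause (cplxVec)
open B15Prop1ChartCalculusSU2 (E3)
open T4CubeChartGnomonic (SU2)
open B14.Eq213DetSet (Bj maxDomT)
open B14.Eq213MaximalDomains (side)
open B14.Eq22Determines (IsBlockUnion)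
open T4AxialGaugeSmallField (boxPlaqs castSite boxBonds)
open B15Prop1Carrier (plaqsInside)
open Literature.MathematicalPhysics.QuantumFieldTheory.BalabanImbrieJaffe1984to88.BIJ85Eq453GaugeField (qsstarGIter0)
open B15ShellGauge193 (shellGauge)
open B15Extension193 (extend)
open B16Sect1Backgrounds (toMS expMul)
open B15Prop1ChartSU2 (su2Chart)
open Metric (ball)
open Summit.QuantumFields.YangMills.BalabanUVNodes.N12MinimiserFamilyKnitRowThm1LettersOnZOfRecordPos (exists_R_hMinRow_of_thm1Letters_alongOrbit_onZ_ofRecord_pos)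
open Summit.QuantumFields.YangMills.BalabanUVNodes.N12AtRecord13Prop1KnitThm1OfRecord (thm1TorusClass_of_variationalThm1RegSepCoP7M)
open B15Prop1Thm1RowsOfExistsUniquePos (thm1TorusClassEU_pos_of_thm1RecordEU_pos)

variable {F : T4Family} {k : ℕ}

/-- ★★★★★ **THE (J0′) ROAD's HEAD OF RECORD, KEYED ON THE TWO NAMED [15]-THEOREM-1 FACTS** — ✓p739277's `exists_R_hMinRow_of_thm1Letters_alongOrbit_onZ_ofRecord_pos` with its two
closed torus-class letters `h15T` ∕ `h15EUT⁺` supplied from K0⁷'s `Node00.VariationalThm1RegSepCoP7M F 2 B₃ a₀ a₁` and the lane's `B11Thm1ExistsUniqueCoP7M.VariationalThm1EUSepCoP7M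
F 2 B₃ a₀ a₁` by the two flat-history junctions; every other binder and the conclusion VERBATIM.
[cite: Balaban1985Variational, (1) p.277, (2)–(7) p.278, Thm 1 (8) p.279, Sect. C (44)–(48) p.285, (81)–(83) p.290, Sect. G pp.305–307, (181) p.307, Prop. 9 (190) p.309; Balaban1989LargeFieldI, (i) p.177, (1.74) p.192, p.193 L14–20, Prop. 1 p.194; Balaban1988Convergent, (2.1) p.254, (2.2) p.255, p.255 (after (2.3)), (2.5) p.255, (2.12)–(2.13) pp.256–257, (2.18) p.257; Balaban1985RegularSpaces, (1.3)–(1.9) p.77; Balaban1989LargeFieldII, p.357, (1.7)–(1.9) p.358, (1.12)–(1.13) p.359] -/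
theorem exists_R_hMinRow_of_variationalThm1NamedFacts_alongOrbit_onZ_ofRecord (ν : Node00.Stage7Numerics) (Kt : ℕ) (hd3 : 3 ≤ (F.P Kt).d) (Z : Set (Site (F.P Kt) 0))
    (hkK : k + 1 ≤ (F.P Kt).m + (F.P Kt).K) (hk1 : 1 ≤ k) (hdiv : side (F.P Kt).L ν.M₁ k ∣ (F.P Kt).sitesPerDir 0) (hfloor : ((F.P Kt).d + 14) * (F.P Kt).L ≤ ν.M₁) (hZblk : IsBlockUnion k Z)
    -- (σ)_N OF RECORD, onZ EDITION (dag-n12-w6 g18's `N12GaugeLetterLocExplicitOnZ.exists_gaugeLetterLoc_atRecord_explicit_onZ` inside the lane's U3-onZ), instance-level NUMERICS verbatim: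
    -- NUMERICS (i): a level guard `k + c ≤ m + K` with `4d + m′ + 3 < 2·L^c` (no wrapping), and `M₁ ≥ (4d + m′)·L² + 2d·L + 12` (radii), `m′ = 3·(d·((L−1)∕2)) + 5`
    {c : ℕ} (hkc : k + c ≤ (F.P Kt).m + (F.P Kt).K) (hc : 4 * (F.P Kt).d + (3 * ((F.P Kt).d * (((F.P Kt).L - 1) / 2)) + 5) + 3 < 2 * (F.P Kt).L ^ c)
    (hMrad : (4 * (F.P Kt).d + (3 * ((F.P Kt).d * (((F.P Kt).L - 1) / 2)) + 5)) * (F.P Kt).L ^ 2 + 2 * (F.P Kt).d * (F.P Kt).L + 12 ≤ ν.M₁)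
    -- the family's support numerics: `M₁ ≥ ((d+4)L + 6)·L²`
    (hM₁ : (((F.P Kt).d + 4) * (F.P Kt).L + 6) * (F.P Kt).L ^ 2 ≤ ν.M₁)
    -- THE TWO [15]-THEOREM-1 NAMED FACTS IN NODE 00's HOUSE SHAPE, BY NAME: (8) = K0⁷'s `Node00.VariationalThm1RegSepCoP7M` (stmt-QuantumFields-20541's body; «INHABITED BY»: OPEN —
    -- K0⁷'s item) and (E∕U) = the lane's `B11Thm1ExistsUniqueCoP7M.VariationalThm1EUSepCoP7M` (g29; «INHABITED BY»: OPEN — NO producer in the tree, an N07 ∕ NODE-00 obligation)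
    {B₃ a₀ a₁ : ℝ} (h15 : Node00.VariationalThm1RegSepCoP7M F 2 B₃ a₀ a₁) (h15EU : B11Thm1ExistsUniqueCoP7M.VariationalThm1EUSepCoP7M F 2 B₃ a₀ a₁) :
    -- the per-height letters DISCHARGED (dag-n12-w6 `N12HsurjOfClass.exists_hsurjLetters`): the radius `ρ″` and the window tolerance `εH` announced from (instance, height) alone
    ∃ ρ'' εH : ℝ, 0 < ρ'' ∧ 0 < εH ∧
    ∃ δ₀ : ℝ, 0 < δ₀ ∧
    ∀ (Λ : Set (Site (F.P Kt) 0)) (lo hi : Fin (F.P Kt).d → ℤ) (eR : ℝ), 0 < eR →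
    ∀ (n : ℕ), (∀ κ, hi κ ≤ lo κ + n) → (∀ κ, ((hi κ - lo κ + 1).toNat : ℤ) + 5 < ((F.P Kt).sitesPerDir k : ℤ)) → lo ≤ hi →
      pts k Λ = (castSite '' Set.Icc lo hi : Set (Site (F.P Kt) k)) → (boxPlaqs (lo - 1) (hi + 1) : Set (Plaq (F.P Kt) k)) ⊆ plaqsInside (pts k Z) →
    -- THE REGION BOX of the direct road (dag-n12-w6 §7's big box): `LO ≤ lo − 1`, `hi + 1 ≤ HI`, side budget `n′ < sitesPerDir k`, its plaquettes inside `Z^{(k)}`, and BOX SCOPE: every `k`-bond inside `Z^{(k)}` is a bond of the box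
    -- (= print's STANDING shape condition on the class-(i) large-field components: [Balaban1988Convergent] p.255 after (2.3) «if a component of Z_j is contained in a cube of the size
    -- 100MR_j, then it is a rectangular parallelepiped», [Balaban1989LargeFieldI] (i) p.177 — lit-balaban ME #45∕#46; not a narrowing of print's instance family)
    ∀ (LO HI : Fin (F.P Kt).d → ℤ) (n' : ℕ), LO ≤ lo - 1 → hi + 1 ≤ HI → (∀ κ, HI κ ≤ LO κ + n') → n' < (F.P Kt).sitesPerDir k →
      (boxPlaqs LO HI : Set (Plaq (F.P Kt) k)) ⊆ plaqsInside (pts k Z) → {e : PBond (F.P Kt) k | e.src ∈ pts k Z ∧ e.tgt ∈ pts k Z} ⊆ boxBonds LO HI →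
    ∀ {cE : ℝ}, 12 * ((F.P Kt).d : ℝ) * ((n : ℝ) + 2) ^ 2 ≤ cE → 6 * ((((F.P Kt).d - 1 : ℕ)) : ℝ) * (F.P Kt).L ^ k * (2 * ((cE + 1) * eR)) ≤ ρ'' →
    ∀ (ext : GaugeField (F.P Kt) k SU2 → GaugeField (F.P Kt) k SU2), (∀ W, ext W = extend (pts k Λ) (shellGauge W lo hi) W) →
    ∀ {𝓐₀ : ℝ}, 1 < 𝓐₀ →
    ∀ (εr : ℝ), 0 < εr → 12 * ((((F.P Kt).d - 1 : ℕ)) : ℝ) * (F.P Kt).L * εr ≤ ρ'' → εr ≤ εH →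
      (143 * (((((F.P Kt).d + 4 : ℕ) : ℝ)) ^ 2 / 4) ^ 2) * (2 * ((F.P Kt).L : ℝ) ^ 2 * εr) ≤ 1 / 3 →
      2 * (2 * ((F.P Kt).L : ℝ) ^ 2 * εr) ≤ 2 * deltaSU (Fin 2) / ((((F.P Kt).d + 4) * (F.P Kt).L : ℕ) : ℝ) ^ 2 →
    -- [15]'s comparability rows at `ε := 2eR`
    ∀ {ε₀ : ℝ}, (cE + 1) * (2 * eR) ≤ a₁ → B₃ * ((cE + 1) * (2 * eR)) ≤ εr → εr < ε₀ → ε₀ ≤ a₀ →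
    -- the datum bond tolerance `ρn` with U3's «`T(ρn, εr) ≤ δ₀`» row (VERBATIM)
    ∀ {ρn : ℝ}, 0 ≤ ρn →
    (max ρn ((((2 * (∑ i ∈ Finset.range (k + 1), ((F.P Kt).d * (((F.P Kt).L ^ i - 1) / 2) + 1)) + 1 +
                  (3 * ((F.P Kt).d * (((F.P Kt).L - 1) / 2)) + 5) * (F.P Kt).L ^ k : ℕ) : ℝ)) ^ 2 / 4 * (εr * (F.P Kt).eta 0 ^ 2) +
                ((3 * ((F.P Kt).d * (((F.P Kt).L - 1) / 2)) + 5 : ℕ) : ℝ) * (6 * ((((((F.P Kt).d + 2) * (F.P Kt).L : ℕ) : ℝ) ^ 2 / 4) * (2 * (εr * (F.P Kt).L ^ 2))) * ∑ i ∈ Finset.range k, ((F.P Kt).L : ℝ) ^ i) + ((3 * ((F.P Kt).d * (((F.P Kt).L - 1) / 2)) + 5 : ℕ) : ℝ) * ρn) ≤ δ₀) →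
    -- the normaliser's bond tolerance (dag-n12-w6 §7, at `ε := eR`) below the datum tolerance `ρn`
    (((F.P Kt).d : ℝ) * n' + 1) * ((((F.P Kt).d - 1 : ℕ) : ℝ) * n' * ((12 * (F.P Kt).d * (n + 2) ^ 2 + 1) * eR) + 3 * (F.P Kt).d * (n + 2) ^ 2 * eR) ≤ ρn →
    -- NO PER-BASE-FIELD HYPOTHESIS AND NO ANTECEDENT: the knit's `hMin` ∀-body for EVERY base field of the strict guard, bound `4𝓐₀`
    ∃ R : ℝ, 0 < R ∧ ∀ Vk : GaugeField (F.P Kt) k SU2, PlaqSmallOn (plaqsInside (pts k (Z ∩ Λᶜ))) eR Vk →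
      ∃ Ũ : VecField (F.P Kt) k (EuclideanSpace ℂ (Fin 3)) × VecField (F.P Kt) k (EuclideanSpace ℂ (Fin 3)) → PBond (F.P Kt) 0 → Matrix (Fin 2) (Fin 2) ℂ,
        (∀ b i j, DifferentiableOn ℂ (fun z => Ũ z b i j) (ball 0 R)) ∧
        (∀ z ∈ ball (0 : VecField (F.P Kt) k (EuclideanSpace ℂ (Fin 3)) × VecField (F.P Kt) k (EuclideanSpace ℂ (Fin 3))) R, ∀ b i j, ‖Ũ z b i j‖ ≤ 4 * 𝓐₀) ∧
        ∀ p B' : VecField (F.P Kt) k E3, ‖p‖ < R → ‖B'‖ < R → ∃ U' : GaugeField (F.P Kt) 0 SU2,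
          (∀ b, Ũ (cplxVec p, cplxVec B') b = ((U' b : SU2) : Matrix (Fin 2) (Fin 2) ℂ)) ∧
            IsMinimizer (Node00.avOfRecord F 2 Kt) (Node00.regMSCoPOfRecord F 2 {ν with εreg := εr} Kt k (maxDomT ν.M₁ Z)) (Bj ν.M₁ Z k)
              (avgFamily (Node00.avOfRecord F 2 Kt) (qsstarGIter0 k (expMul su2Chart B' (ext (expMul su2Chart p Vk))))) U' :=
  exists_R_hMinRow_of_thm1Letters_alongOrbit_onZ_ofRecord_pos ν Kt hd3 Z hkK hk1 hdiv hfloor hZblk hkc hc hMrad hM₁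
    (thm1TorusClass_of_variationalThm1RegSepCoP7M ν Kt h15) (thm1TorusClassEU_pos_of_thm1RecordEU_pos ν Kt h15EU)

end Summit.QuantumFields.YangMills.BalabanUVNodes.N12MinimiserFamilyKnitRowThm1NamedFactsOnZOfRecord

end
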